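import Summits.BirchSwinnertonDyer.BirchSwinnertonDyer.Theorems.BiquadraticEisensteinDescentHeegnerTwistCouplingInSupplyKrizLiCornerClassNumberForm
import Literature.NumberTheory.EllipticCurves.Rank1Residual.Predicates
import HarnessLib

set_option linter.dupNamespace false -- `Summit.BirchSwinnertonDyer.BirchSwinnertonDyer.Theorems.…` (summit = sub, D-0017)
set_option autoImplicit false

/-!
# Crux `HeegnerTwistCouplingInSupply` (stmt-BirchSwinnertonDyer-21381) — the crux's BODY verbatim on the two Kriz–Li corners
# (QT27₊ / X12₊, class-number certificates): the shape a line's `HeegnerTwistCouplingInSupply_of` can call by name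

Route `BiquadraticEisensteinDescent` (cell `pub/bsd-wall`, width seat `bsd-wall-cm-bed-w4` g27; `--supports` 21381, helper). For a
KL3-regular prime `q ≡ 2 (mod 3)` and ONE prime certificate `r` (KL3-CORNERS (S3) at `K′ = ℚ(√−r)`): the registered crux statement
`Summit.BirchSwinnertonDyer.BirchSwinnertonDyer.Theses.BiquadraticEisensteinDescent.HeegnerTwistCouplingInSupply`, whose body is
`W.HasCM → r_an(W) = 1 → 5 ≤ p → CMInert W p → ¬ Good W p → (supply) → ∃ K′ …`, holds AT `(W, q)` for every globally minimal
`W ≅ y² = x³ + q·m²` of the corner (`27a^{(q)}`, `36a1^{(q)}`) — `HasCM`, `5 ≤ q`, `CMInert`, `¬Good` and the supply are IDLE, `r_an = 1`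
is used as `r_an ≠ 0` — modulo `hKL` (Kriz–Li 1.20), `hGZ` (Gross–Zagier), `hHP` (Heegner points). The Theses module is NOT imported
(the body is spelled out, as in `SylvesterCorner.heegnerTwistCouplingInSupply_of_eq_sylvester`), so this file stays a helper.

HONEST FRAMING: corner layer; the crux (all CM `W`, all `p`), C⁺ / (S3′)(p), its stubs and BSD are NOT proved. THEOREMS ONLY.
Supports stmt-BirchSwinnertonDyer-21381. [cite: KrizLi2019, Thm. 1.20 (pp. 7–8)] [cite: GrossZagier1986, Thm. I.(6.3), V.§1–2] [cite: Washington1997, Thm. 4.17]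
-/

noncomputable section

open scoped Classical NumberTheorySymbols

namespace Summit.BirchSwinnertonDyer.BirchSwinnertonDyer.Theorems.KrizLiCornerClassNumber

open _root_.WeierstrassCurve NumberField
open Literature.NumberTheory.EllipticCurves Literature.NumberTheory.EllipticCurves.KrizLi2019
  Literature.NumberTheory.EllipticCurves.ModularForms Literature.NumberTheory.EllipticCurves.Rank1Residual
  Literature.NumberTheory.QuadraticFields Literature.NumberTheory.QuadraticFields.Quadratic

/-- ★ **The crux BODY at `(W, q)`, `q ≡ 5 (mod 12)`** (QT27₊, class-number certificates `3 ∤ h(−3q)`, `3 ∤ h(−qr)`, `h(−r) < q`):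
`HasCM → r_an = 1 → 5 ≤ q → CMInert W q → ¬Good W q → supply → ∃ K′` (Heegner for `N(W)`, `4 < |d|`, `L(W^{(d)},1) ≠ 0`, `q ∤ h`),
for every globally minimal `W ≅ y² = x³ + q·m²` with bad primes `⊂ {3, q}` and `a₂ = 0` if good at `2`; the first five hypotheses
and the supply are idle. [cite: KrizLi2019, Thm. 1.20 (pp. 7–8)] [cite: GrossZagier1986, Thm. I.(6.3), V.§1–2] -/
theorem cruxBody_of_classNumbers (hKL : thm120_padicLogHeegner_unit_of_bernoulli)
    (hGZ : ∀ (N : ℕ) [NeZero N] (W : WeierstrassCurve ℚ) (K : Type) [Field K] [NumberField K], gross_zagier N W K)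
    (hHP : ∀ (W : WeierstrassCurve ℚ) (K : Type) [Field K] [NumberField K], exists_isHeegnerPoint W K)
    {q r : ℕ} [Fact q.Prime] [Fact r.Prime] (hq4 : q % 4 = 1) (hr4 : r % 4 = 3) (hr3 : r ≠ 3) (h1 : jacobiSym 3 q = -1)
    (hs3 : jacobiSym (-(r : ℤ)) 3 = 1) (hsq : jacobiSym (-(r : ℤ)) q = 1)
    (h3q : ¬ 3 ∣ BinQF.classNumber (-((q * 3 : ℕ) : ℤ))) (hqr : ¬ 3 ∣ BinQF.classNumber (-((q * r : ℕ) : ℤ)))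
    {h : ℕ} (hclass : BinQF.classNumber (-(r : ℤ)) = h) (hhq : h < q)
    (W : WeierstrassCurve ℚ) [W.IsElliptic] [W.IsGloballyMinimal] [NeZero (W.conductorNorm ℤ)]
    {m : ℤ} (hm : m ≠ 0) (hW : ∃ C : VariableChange ℚ, C • W = mordellCurve ((q : ℚ) * (m : ℚ) ^ 2))
    (h6 : ∀ ℓ : ℕ, ℓ.Prime → ¬ ((ℓ : ℤ) ^ 6 ∣ (q : ℤ) * m ^ 2))
    (h2 : (haveI : Fact (Nat.Prime 2) := ⟨Nat.prime_two⟩; W.HasGoodReductionAtPrime 2) → W.LFunction 2 = 0)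
    (hS : ∀ ℓ : ℕ, (hℓ : ℓ.Prime) → ¬ (haveI := Fact.mk hℓ; W.HasGoodReductionAtPrime ℓ) → ℓ = 3 ∨ ℓ = q) :
    W.HasCM → W.analyticRank = 1 → 5 ≤ q → CMInert W q → ¬ Good W q →
      (∀ B : ℕ, ∃ (K : Type) (_ : Field K) (_ : NumberField K), IsImaginaryQuadratic K ∧ B < (NumberField.discr K).natAbs ∧
        4 < (NumberField.discr K).natAbs ∧ SatisfiesHeegnerHypothesis (W.conductorNorm ℤ) K ∧ ¬ q ∣ NumberField.classNumber K) →
      ∃ (K : Type) (_ : Field K) (_ : NumberField K),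
        IsImaginaryQuadratic K ∧ 4 < (NumberField.discr K).natAbs ∧
        SatisfiesHeegnerHypothesis (W.conductorNorm ℤ) K ∧
        (W.quadraticTwist (NumberField.discr K : ℚ)).entireLFunction 1 ≠ 0 ∧ ¬ q ∣ NumberField.classNumber K :=
  fun _ hr _ _ _ _ => exists_cruxConclusion_of_classNumbers hKL hGZ hHP hq4 hr4 hr3 h1 hs3 hsq h3q hqr hclass hhq W hm hW h6 h2
    (fun ℓ hℓ hbad => (hS ℓ hℓ hbad).elim Or.inl fun h => Or.inr (Or.inl h)) (by rw [hr]; exact one_ne_zero)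

/-- ★ **The crux BODY at `(W, q)`, `q ≡ 11 (mod 12)`** (X12₊ ∪ QT27₊, class-number certificates `3 ∤ h(−12q)`, `3 ∤ h(−4qr)`,
`h(−r) < q`; `r ≡ 7 (mod 8)`): as above for every globally minimal `W ≅ y² = x³ + q·m²` with bad primes `⊂ {2, 3, q}`.
[cite: KrizLi2019, Thm. 1.20 (pp. 7–8)] [cite: GrossZagier1986, Thm. I.(6.3), V.§1–2] -/
theorem cruxBody_three_mod_four_of_classNumbers (hKL : thm120_padicLogHeegner_unit_of_bernoulli)
    (hGZ : ∀ (N : ℕ) [NeZero N] (W : WeierstrassCurve ℚ) (K : Type) [Field K] [NumberField K], gross_zagier N W K)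
    (hHP : ∀ (W : WeierstrassCurve ℚ) (K : Type) [Field K] [NumberField K], exists_isHeegnerPoint W K)
    {q r : ℕ} [Fact q.Prime] [Fact r.Prime] (hq4 : q % 4 = 3) (h3j : jacobiSym 3 q = 1) (hr8 : r % 8 = 7) (hr3 : r ≠ 3)
    (hs3 : jacobiSym (-(r : ℤ)) 3 = 1) (hsq : jacobiSym (-(r : ℤ)) q = 1)
    (h12q : ¬ 3 ∣ BinQF.classNumber (-((4 * q * 3 : ℕ) : ℤ))) (h4qr : ¬ 3 ∣ BinQF.classNumber (-((4 * q * r : ℕ) : ℤ)))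
    {h : ℕ} (hclass : BinQF.classNumber (-(r : ℤ)) = h) (hhq : h < q)
    (W : WeierstrassCurve ℚ) [W.IsElliptic] [W.IsGloballyMinimal] [NeZero (W.conductorNorm ℤ)]
    {m : ℤ} (hm : m ≠ 0) (hW : ∃ C : VariableChange ℚ, C • W = mordellCurve ((q : ℚ) * (m : ℚ) ^ 2))
    (h6 : ∀ ℓ : ℕ, ℓ.Prime → ¬ ((ℓ : ℤ) ^ 6 ∣ (q : ℤ) * m ^ 2))
    (h2 : (haveI : Fact (Nat.Prime 2) := ⟨Nat.prime_two⟩; W.HasGoodReductionAtPrime 2) → W.LFunction 2 = 0)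
    (hS : ∀ ℓ : ℕ, (hℓ : ℓ.Prime) → ¬ (haveI := Fact.mk hℓ; W.HasGoodReductionAtPrime ℓ) → ℓ = 2 ∨ ℓ = 3 ∨ ℓ = q) :
    W.HasCM → W.analyticRank = 1 → 5 ≤ q → CMInert W q → ¬ Good W q →
      (∀ B : ℕ, ∃ (K : Type) (_ : Field K) (_ : NumberField K), IsImaginaryQuadratic K ∧ B < (NumberField.discr K).natAbs ∧
        4 < (NumberField.discr K).natAbs ∧ SatisfiesHeegnerHypothesis (W.conductorNorm ℤ) K ∧ ¬ q ∣ NumberField.classNumber K) →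
      ∃ (K : Type) (_ : Field K) (_ : NumberField K),
        IsImaginaryQuadratic K ∧ 4 < (NumberField.discr K).natAbs ∧
        SatisfiesHeegnerHypothesis (W.conductorNorm ℤ) K ∧
        (W.quadraticTwist (NumberField.discr K : ℚ)).entireLFunction 1 ≠ 0 ∧ ¬ q ∣ NumberField.classNumber K :=
  fun _ hr _ _ _ _ => exists_cruxConclusion_three_mod_four_of_classNumbers hKL hGZ hHP hq4 h3j hr8 hr3 hs3 hsq h12q h4qr hclass
    hhq W hm hW h6 h2 hS (by rw [hr]; exact one_ne_zero)

end Summit.BirchSwinnertonDyer.BirchSwinnertonDyer.Theorems.KrizLiCornerClassNumber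

end
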